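import Mathlib
import Literature.MathematicalPhysics.MHD.CerfonFreidbergSolutions
import HarnessLib

/-!
# The Cerfon–Freidberg families (6.153)/(6.160) are `Cⁿ` (every `n`) as functions of `(X, Y)` off the symmetry axis `X = 0`

Topic `Literature/MathematicalPhysics/MHD` (namespace `Literature.MathematicalPhysics.MHD.CerfonFreidberg`).  The analytic
Grad–Shafranov solutions of Cerfon–Freidberg, `U = U_P + Σ_j c_j U_j` with the `U_j` of [cite: Freidberg2014, §6.6.1 eq. (6.153)]
(up–down symmetric) and [cite: Freidberg2014, §6.6.5 eq. (6.160)–(6.161)] (asymmetric), are polynomials in `X`, `Y` and `ln X`;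
hence JOINTLY `Cⁿ` in `(X, Y)` for every `n : ℕ∞ω` at every point with `X ≠ 0`, in particular on the physical half-plane `X = R/R₀ > 0`.
The tree already holds the slot-wise partials (`CerfonFreidbergAlphaZeroDerivatives.lean`: `dR`, `dZ`, `dRR`, `dZZ` closed forms);
this file adds the two-variable regularity statement (`ContDiffAt` / `ContDiffOn` / `HasFDerivAt` of the UNCURRIED `U`), which is
what level-set calculus on flux surfaces consumes (LADDER-GRIDFUSION F2 R2: the polar-ray files
`Summits/Ventures/FusionMHD/Models/FluxSurfacePolarRay{,Glue,Deriv,Loop}.lean` take «`ψ` Fréchet-differentiable / C¹ at the loop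
point» as their only hypothesis on `ψ`).  Proof: `fun_prop` on the written-out formula (`Real.log` is `Cⁿ` off `0`).
Typer/prover: gridfusion-model-7 (g3), 2026-08-27.  Nothing here is specific to an instance; no numerics.
-/

noncomputable section

namespace Literature.MathematicalPhysics.MHD.CerfonFreidberg

open _root_.Real Function

/-- **`U = U_P + Σ c_j U_j` of (6.153) is `Cⁿ` in `(X, Y)` at every point with `X ≠ 0`** (polynomials in `X, Y, ln X`), for every
`n : ℕ∞ω` and every `α`, `c`. [cite: Freidberg2014, §6.6.1 eq. (6.153)] -/
theorem contDiffAt_cfSolution (α : ℝ) (c : Fin 7 → ℝ) {n : WithTop ℕ∞} {X Y : ℝ} (hX : X ≠ 0) :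
    ContDiffAt ℝ n (fun p : ℝ × ℝ => cfSolution α c p.1 p.2) (X, Y) := by
  unfold cfSolution UP U0 U1 U2 U3 U4 U5 U6
  have hX' : ((X, Y) : ℝ × ℝ).1 ≠ 0 := hX
  fun_prop (disch := exact hX')

/-- The same for the up–down asymmetric family (6.160). [cite: Freidberg2014, §6.6.5 eq. (6.160)] -/
theorem contDiffAt_cfSolutionAsym (α : ℝ) (c : Fin 12 → ℝ) {n : WithTop ℕ∞} {X Y : ℝ} (hX : X ≠ 0) :
    ContDiffAt ℝ n (fun p : ℝ × ℝ => cfSolutionAsym α c p.1 p.2) (X, Y) := by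
  unfold cfSolutionAsym UP U0 U1 U2 U3 U4 U5 U6 U7 U8 U9 U10 U11
  have hX' : ((X, Y) : ℝ × ℝ).1 ≠ 0 := hX
  fun_prop (disch := exact hX')

/-- Hence `U` (6.153) is `Cⁿ` on the open right half-plane `{X > 0}` (the physical domain `R > 0`). [cite: Freidberg2014, §6.6.1 eq. (6.153)] -/
theorem contDiffOn_cfSolution (α : ℝ) (c : Fin 7 → ℝ) {n : WithTop ℕ∞} :
    ContDiffOn ℝ n (fun p : ℝ × ℝ => cfSolution α c p.1 p.2) {p : ℝ × ℝ | 0 < p.1} := fun p hp =>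
  (contDiffAt_cfSolution α c (n := n) (X := p.1) (Y := p.2) (ne_of_gt hp)).contDiffWithinAt

/-- … and Fréchet-differentiable at every point with `X ≠ 0`, with derivative `fderiv`. [cite: Freidberg2014, §6.6.1 eq. (6.153)] -/
theorem hasFDerivAt_cfSolution (α : ℝ) (c : Fin 7 → ℝ) {X Y : ℝ} (hX : X ≠ 0) :
    HasFDerivAt (fun p : ℝ × ℝ => cfSolution α c p.1 p.2)
      (fderiv ℝ (fun p : ℝ × ℝ => cfSolution α c p.1 p.2) (X, Y)) (X, Y) :=
  ((contDiffAt_cfSolution α c (n := 1) (Y := Y) hX).differentiableAt one_ne_zero).hasFDerivAt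

end Literature.MathematicalPhysics.MHD.CerfonFreidberg

end
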